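import Summits.FinalStateConjecture.FinalStateConjecture.Theorems.TameCensorship.Negative.GenericityModel
import Literature.Geometry.Lorentzian.TameBreathingCurve
import Literature.Geometry.Lorentzian.TrivialDataAdmissible
import Literature.Geometry.Lorentzian.ModelDataProofs
import Literature.Geometry.Lorentzian.AFEndChartEmbedding

/-!
# The breathing observable on the admissible class of `ℝ³` (model for `TameGenericityAndFails.lean`)
(negative-side support for crux `TameCensorship`, `stmt-FinalStateConjecture-17431`, route
`PhotonSphereChannels`; cdisprove seat, 2026-08-17)

The bookkeeping of a two-ball breathing model INSIDE Christodoulou's admissible class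
`admissibleVacuumData Minkowski.slice` of the crux, used by `TameGenericityAndFails.lean` to show that the
summit's TAME genericity is not closed under conjunction:

* the observable coordinate `u(D, z) = h₁₁(z)` (`Tame.obs`: the `(e₀, e₀)` chart component of the metric
  of `D` at the coordinate point `z` in the chart of the standard end `trivialAFEnd`), positive on the
  end (`obs_pos`), equal to `1` at the trivial datum (`obs_trivialData`, from `hCoeff_trivialAFEnd`);
* two disjoint breathing balls of radius `1` about `z₁ = 4e₀`, `z₂ = −4e₀` (`B₁`, `B₂`) and the laws of
  motion of the observable under the tree's breathing curves (`AFEnd.breatheFamily`, pull-backs along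
  compactly supported ball dilations): the CENTRE LAW `u ↦ (1 + σ t)² u` at the breathed centre
  (`obs_breatheFamily_center`, from `breatheFamily_h_inner_center`) and the OFF-CENTRE LAW (no change off
  the moved core, `obs_breatheFamily_of_not_mem`), i.e. horizontal / vertical motions of the pair
  `Φ(D) = (u(D, z₁) − 1, u(D, z₂) − 1)` (`obsPair_curve₁`, `obsPair_curve₂`);
* the breathing curves as legal witness curves of TAME genericity through an ADMISSIBLE datum
  (`curve_witness`): jointly smooth, injective, immersed at `0`, admissible members
  (`TameBreathingCurve.lean`), and tame on a collar of the datum's OWN sole end although the breathing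
  is done in the chart of the standard end (`isTameDataFamily_curve`: split ends are allowed because
  tameness of a family agreeing with its base off a compact set only needs the base datum's flat sole
  end, `isTameDataFamily_restrict_of_agree_off_compact_one`);
* continuity of the observable along every jointly smooth family (`continuous_obs_family`, from
  `AFEnd.contDiffAt_hCoeff_family`) — the input of the level-set trap.

Christodoulou, CQG 16 (1999) A23, p. A24 (genericity inside a fixed space of data); Lee, *Introduction to
Smooth Manifolds* (2013), Prop. 2.25 (bump-function diffeomorphisms). Everything is proved; the `def`s
are model bookkeeping (points, the observable), not mathematical facts.
-/

set_option linter.dupNamespace false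

noncomputable section

open Set Function Filter Metric TopologicalSpace
open scoped Manifold ContDiff Topology

namespace Summit.FinalStateConjecture.FinalStateConjecture.Theorems.TameCensorship.Negative

open Literature.Geometry.Lorentzian

namespace Tame

/-! ### Two breathing balls on the standard end of `ℝ³` and the observable -/

/-- The admissible class of the crux on `Σ = ℝ³` (the Minkowski slice). -/
abbrev 𝓓 : Set (InitialDataSet (𝓡 3) Minkowski.slice) := admissibleVacuumData Minkowski.slice

/-- The unit vector `e₀ = (1, 0, 0)` of `ℝ³`. -/
def v : E3 := EuclideanSpace.single (0 : Fin 3) (1 : ℝ)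

/-- `‖e₀‖ = 1`. -/
theorem norm_v : ‖v‖ = 1 := by simp [v]

/-- `e₀ ≠ 0`. -/
theorem v_ne_zero : v ≠ 0 := by
  rw [← norm_ne_zero_iff, norm_v]; exact one_ne_zero

/-- The first breathing centre `z₁ = 4 e₀`. -/
def z₁ : E3 := (4 : ℝ) • v

/-- The second breathing centre `z₂ = −4 e₀`. -/
def z₂ : E3 := (-4 : ℝ) • v

/-- `‖z₁‖ = 4`. -/
theorem norm_z₁ : ‖z₁‖ = 4 := by rw [z₁, norm_smul, norm_v]; norm_num

/-- `‖z₂‖ = 4`. -/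
theorem norm_z₂ : ‖z₂‖ = 4 := by rw [z₂, norm_smul, norm_v]; norm_num

/-- The centres are `8` apart. -/
theorem dist_z₁_z₂ : dist z₁ z₂ = 8 := by
  rw [dist_eq_norm, z₁, z₂, ← sub_smul, norm_smul, norm_v]; norm_num

/-- The centres are `8` apart. -/
theorem dist_z₂_z₁ : dist z₂ z₁ = 8 := by rw [dist_comm, dist_z₁_z₂]

/-- Breathing data on the unit ball about `z₁` on the end `trivialAFEnd` (`R = 1 < 4 − 2`). -/
theorem B₁ : trivialAFEnd.BreathingData z₁ 1 :=
  ⟨one_pos, by rw [trivialAFEnd_R, norm_z₁]; norm_num⟩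

/-- Breathing data on the unit ball about `z₂`. -/
theorem B₂ : trivialAFEnd.BreathingData z₂ 1 :=
  ⟨one_pos, by rw [trivialAFEnd_R, norm_z₂]; norm_num⟩

/-- `z₁` lies on the end. -/
theorem R_lt_z₁ : trivialAFEnd.R < ‖z₁‖ := B₁.R_lt_norm_center

/-- `z₂` lies on the end. -/
theorem R_lt_z₂ : trivialAFEnd.R < ‖z₂‖ := B₂.R_lt_norm_center

/-- **The observable coordinate** `u(D, z) = h₁₁(z)`: the `(e₀, e₀)` chart component of the metric
of `D` at the coordinate point `z`, in the chart of the standard end of `ℝ³`. -/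
def obs (D : InitialDataSet (𝓡 3) Minkowski.slice) (z : E3) : ℝ :=
  AFEnd.hCoeff trivialAFEnd D z v v

/-- On the end, `u(D, z) = h_D(Φₑ z)(dΦₑ e₀, dΦₑ e₀)` (`hCoeff_apply_eq_dataChartExt`). -/
theorem obs_eq (D : InitialDataSet (𝓡 3) Minkowski.slice) {z : E3} (hz : trivialAFEnd.R < ‖z‖) :
    obs D z = D.h.inner (trivialAFEnd.dataChartExt z)
      (mfderiv 𝓘(ℝ, E3) (𝓡 3) trivialAFEnd.dataChartExt z v)
      (mfderiv 𝓘(ℝ, E3) (𝓡 3) trivialAFEnd.dataChartExt z v) :=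
  trivialAFEnd.hCoeff_apply_eq_dataChartExt D hz v v

/-- The observable coordinate is positive on the end (`h` is Riemannian, the chart an immersion). -/
theorem obs_pos (D : InitialDataSet (𝓡 3) Minkowski.slice) {z : E3} (hz : trivialAFEnd.R < ‖z‖) :
    0 < obs D z := by
  rw [obs_eq D hz]
  refine D.h.pos _ _ fun h ↦ v_ne_zero ?_
  exact trivialAFEnd.injective_mfderiv_dataChartExt hz
    (h.trans (map_zero (mfderiv 𝓘(ℝ, E3) (𝓡 3) trivialAFEnd.dataChartExt z)).symm)

/-- At the trivial datum the observable coordinate is `1` everywhere (`hCoeff = δ`). -/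
theorem obs_trivialData (z : E3) : obs trivialData z = 1 := by
  rw [obs, hCoeff_trivialAFEnd, innerSL_apply_apply, real_inner_self_eq_norm_sq, norm_v, one_pow]

/-- **Centre law.** Breathing about `z` multiplies `u(·, z)` by `(1 + σ t)²`. -/
theorem obs_breatheFamily_center {z : E3} (B : trivialAFEnd.BreathingData z 1)
    (D : InitialDataSet (𝓡 3) Minkowski.slice) (t : ℝ) :
    obs (AFEnd.breatheFamily B D t) z = (1 + AFEnd.squash B t) ^ 2 * obs D z := by
  rw [obs_eq _ B.R_lt_norm_center, obs_eq _ B.R_lt_norm_center]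
  exact AFEnd.breatheFamily_h_inner_center B D t _ _

/-- A coordinate point at distance `> 3/4` from the breathing centre is not in the moved core. -/
theorem not_mem_breatheCore {z z' : E3} (B : trivialAFEnd.BreathingData z 1)
    (hz' : trivialAFEnd.R < ‖z'‖) (hfar : 3 / 4 < dist z' z) :
    trivialAFEnd.dataChartExt z' ∉ AFEnd.breatheCore trivialAFEnd z 1 := by
  rintro ⟨w, hw, hweq⟩
  have hwR : trivialAFEnd.R < ‖w‖ :=
    B.R_lt_norm_of_mem_ball (closedBall_subset_ball (by norm_num) hw)
  have h := congrArg trivialAFEnd.coord hweq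
  rw [trivialAFEnd.coord_dataChartExt_of_lt hwR, trivialAFEnd.coord_dataChartExt_of_lt hz'] at h
  subst h
  rw [mem_closedBall] at hw
  linarith

/-- **Off-centre law.** Breathing about `z` does not change `u(·, z')` for `z'` off the core. -/
theorem obs_breatheFamily_of_not_mem {z z' : E3} (B : trivialAFEnd.BreathingData z 1)
    (D : InitialDataSet (𝓡 3) Minkowski.slice) (t : ℝ)
    (hz' : trivialAFEnd.R < ‖z'‖) (hfar : 3 / 4 < dist z' z) :
    obs (AFEnd.breatheFamily B D t) z' = obs D z' := by
  rw [obs_eq _ hz', obs_eq _ hz',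
    (AFEnd.breatheFamily_eq_of_not_mem_core B D t (not_mem_breatheCore B hz' hfar)).1]

/-- `σ t ≠ 0` for `t ≠ 0`. -/
theorem squash_ne_zero {z : E3} (B : trivialAFEnd.BreathingData z 1) {t : ℝ} (ht : t ≠ 0) :
    AFEnd.squash B t ≠ 0 :=
  fun h ↦ ht (AFEnd.squash_injective B (by rw [h, AFEnd.squash_zero]))

/-- **The observable** `Φ(D) = (u(D, z₁) − 1, u(D, z₂) − 1) ∈ ℝ²`; `Φ(trivialData) = 0`. -/
def obsPair (D : InitialDataSet (𝓡 3) Minkowski.slice) : ℝ × ℝ := (obs D z₁ - 1, obs D z₂ - 1)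

/-- `Φ(trivialData) = 0`. -/
theorem obsPair_trivialData : obsPair trivialData = 0 := by
  simp [obsPair, obs_trivialData]

/-! ### The breathing curves as tame admissible witness curves (split ends) -/

/-- The breathing curve of `D` about the ball of `B`, parametrised by `ℝ¹`. -/
def curve {z : E3} (B : trivialAFEnd.BreathingData z 1) (D : InitialDataSet (𝓡 3) Minkowski.slice) :
    EuclideanSpace ℝ (Fin 1) → InitialDataSet (𝓡 3) Minkowski.slice :=
  fun c ↦ AFEnd.breatheFamily B D (c 0)

/-- **Tameness with split ends.** The breathing curve (breathing in the chart of the STANDARD end) is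
tame on a collar of ANY sole end `E` on which `D` is Dafermos–Rodnianski flat — in particular on the
datum's own admissible end: all members agree with `D` off the compact core. -/
theorem isTameDataFamily_curve {z : E3} (B : trivialAFEnd.BreathingData z 1)
    {D : InitialDataSet (𝓡 3) Minkowski.slice} {E : AFEnd Minkowski.slice} (hE : E.IsSoleEnd)
    {M : ℝ} (hSAF : E.IsStronglyAsymptoticallyFlatDR D M) {R₁ : ℝ} (hR₁ : E.R < R₁) :
    InitialDataSet.IsTameDataFamily (E.restrict hR₁.le) 1 (curve B D) := by
  have h0 : AFEnd.breatheFamily B D ((0 : EuclideanSpace ℝ (Fin 1)) 0) = D :=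
    AFEnd.breatheCurve_zero B D
  refine InitialDataSet.isTameDataFamily_restrict_of_agree_off_compact_one
    (AFEnd.isSmoothDataFamily_breatheCurve B D) hE (M := M) ?_ (AFEnd.isCompact_breatheCore B) ?_ hR₁
  · show E.IsStronglyAsymptoticallyFlatDR
      (AFEnd.breatheFamily B D ((0 : EuclideanSpace ℝ (Fin 1)) 0)) M
    rw [h0]
    exact hSAF
  · intro c x hx
    show (AFEnd.breatheFamily B D (c 0)).h.inner x =
        (AFEnd.breatheFamily B D ((0 : EuclideanSpace ℝ (Fin 1)) 0)).h.inner x ∧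
      (AFEnd.breatheFamily B D (c 0)).k x =
        (AFEnd.breatheFamily B D ((0 : EuclideanSpace ℝ (Fin 1)) 0)).k x
    rw [h0]
    exact AFEnd.breatheFamily_eq_of_not_mem_core B D (c 0) hx

/-- The witness data of a breathing curve through an admissible datum, in the shape consumed by
`isTameChristodoulouGeneric_of_local` (everything but the escape clause). -/
theorem curve_witness {z : E3} (B : trivialAFEnd.BreathingData z 1)
    {D : InitialDataSet (𝓡 3) Minkowski.slice} (hD : D ∈ 𝓓) :
    ∃ E : AFEnd Minkowski.slice, InitialDataSet.IsTameDataFamily E 1 (curve B D) ∧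
      InitialDataSet.IsImmersedAtZero 1 (curve B D) ∧ curve B D 0 = D ∧ Injective (curve B D) ∧
        ∀ c, curve B D c ∈ 𝓓 := by
  obtain ⟨-, E, M, hsole, hdecay⟩ := id hD
  have hR₁ : E.R < E.R + 1 := by linarith
  exact ⟨E.restrict hR₁.le, isTameDataFamily_curve B hsole hdecay hR₁,
    AFEnd.isImmersedAtZero_breatheCurve B D, AFEnd.breatheCurve_zero B D,
    AFEnd.injective_breatheCurve B D, fun c ↦ AFEnd.breatheCurve_mem_admissibleVacuumData B D hD c⟩

/-- The observable along the curve about `z₁`: horizontal motion. -/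
theorem obsPair_curve₁ (D : InitialDataSet (𝓡 3) Minkowski.slice) (c : EuclideanSpace ℝ (Fin 1)) :
    obsPair (curve B₁ D c) = ((1 + AFEnd.squash B₁ (c 0)) ^ 2 * obs D z₁ - 1, obs D z₂ - 1) := by
  show (obs (AFEnd.breatheFamily B₁ D (c 0)) z₁ - 1, obs (AFEnd.breatheFamily B₁ D (c 0)) z₂ - 1) = _
  rw [obs_breatheFamily_center B₁ D (c 0),
    obs_breatheFamily_of_not_mem B₁ D (c 0) R_lt_z₂ (by rw [dist_z₂_z₁]; norm_num)]

/-- The observable along the curve about `z₂`: vertical motion. -/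
theorem obsPair_curve₂ (D : InitialDataSet (𝓡 3) Minkowski.slice) (c : EuclideanSpace ℝ (Fin 1)) :
    obsPair (curve B₂ D c) = (obs D z₁ - 1, (1 + AFEnd.squash B₂ (c 0)) ^ 2 * obs D z₂ - 1) := by
  show (obs (AFEnd.breatheFamily B₂ D (c 0)) z₁ - 1, obs (AFEnd.breatheFamily B₂ D (c 0)) z₂ - 1) = _
  rw [obs_breatheFamily_center B₂ D (c 0),
    obs_breatheFamily_of_not_mem B₂ D (c 0) R_lt_z₁ (by rw [dist_z₁_z₂]; norm_num)]

/-- The moved coordinate differs from the unmoved one when `c ≠ 0`. -/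
theorem moved_ne {z : E3} (B : trivialAFEnd.BreathingData z 1) {u : ℝ} (hu : 0 < u)
    {c : EuclideanSpace ℝ (Fin 1)} (hc : c ≠ 0) :
    (1 + AFEnd.squash B (c 0)) ^ 2 * u - 1 ≠ u - 1 := by
  intro h
  have hs := squash_ne_zero B (euclid1_ne_zero hc)
  have h2 : 2 + AFEnd.squash B (c 0) ≠ 0 := by
    have := AFEnd.one_add_squash_pos B (c 0); intro h'; linarith
  have key : AFEnd.squash B (c 0) * (2 + AFEnd.squash B (c 0)) * u = 0 := by linear_combination h
  exact mul_ne_zero (mul_ne_zero hs h2) hu.ne' key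

/-- Continuity in the parameter of the moved coordinate, and its value at `0`. -/
theorem exists_delta_moved {z : E3} (B : trivialAFEnd.BreathingData z 1) (u : ℝ) {ε : ℝ} (hε : 0 < ε) :
    ∃ δ > (0 : ℝ), ∀ c : EuclideanSpace ℝ (Fin 1), ‖c‖ < δ →
      |((1 + AFEnd.squash B (c 0)) ^ 2 * u - 1) - (u - 1)| < ε := by
  let g : EuclideanSpace ℝ (Fin 1) → ℝ := fun c ↦ (1 + AFEnd.squash B (c 0)) ^ 2 * u - 1
  have hgc : Continuous g := by
    have h1 : Continuous fun c : EuclideanSpace ℝ (Fin 1) ↦ c 0 :=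
      (EuclideanSpace.proj (𝕜 := ℝ) (0 : Fin 1)).continuous
    have h2 : Continuous (AFEnd.squash B) := (AFEnd.contDiff_squash B (n := 0)).continuous
    exact (((continuous_const.add (h2.comp h1)).pow 2).mul continuous_const).sub continuous_const
  have h00 : ((0 : EuclideanSpace ℝ (Fin 1)) 0 : ℝ) = 0 := rfl
  have hg0 : g 0 = u - 1 := by
    show (1 + AFEnd.squash B ((0 : EuclideanSpace ℝ (Fin 1)) 0)) ^ 2 * u - 1 = u - 1
    rw [h00, AFEnd.squash_zero]
    ring
  obtain ⟨δ, hδ, h⟩ := Metric.continuousAt_iff.mp (hgc.continuousAt (x := 0)) ε hε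
  refine ⟨δ, hδ, fun c hc ↦ ?_⟩
  have hcd : dist c 0 < δ := by rwa [dist_zero_right]
  have h' : dist (g c) (g 0) < ε := h hcd
  rw [Real.dist_eq, hg0] at h'
  exact h'

/-- Continuity of the observable coordinate along any jointly smooth family (chart components of a
smooth family are jointly smooth on the end, `AFEnd.contDiffAt_hCoeff_family`). -/
theorem continuous_obs_family {m : ℕ}
    {F : EuclideanSpace ℝ (Fin m) → InitialDataSet (𝓡 3) Minkowski.slice}
    (hF : InitialDataSet.IsSmoothDataFamily m F) {z : E3} (hz : trivialAFEnd.R < ‖z‖) :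
    Continuous fun c ↦ obs (F c) z := by
  have hc : Continuous fun c ↦ AFEnd.hCoeff trivialAFEnd (F c) z := by
    refine continuous_iff_continuousAt.2 fun c ↦ ?_
    have h := (AFEnd.contDiffAt_hCoeff_family (e := trivialAFEnd) hF.1 c hz).continuousAt
    have h2 : ContinuousAt (fun c' : EuclideanSpace ℝ (Fin m) ↦ (c', z)) c :=
      continuousAt_id.prodMk continuousAt_const
    exact ContinuousAt.comp (f := fun c' : EuclideanSpace ℝ (Fin m) ↦ (c', z)) h h2
  exact (hc.clm_apply continuous_const).clm_apply continuous_const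

end Tame

end Summit.FinalStateConjecture.FinalStateConjecture.Theorems.TameCensorship.Negative

end
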